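import Literature.AlgebraicGeometry.Motives.KunnethH1FibreRing
import Literature.AlgebraicGeometry.AbelianSchemes.RigidifiedLineBundleComap
import HarnessLib

/-!
# Comparison plumbing for the cube: pullback-level identities and transport of triviality of a line bundle

Layer `Literature/AlgebraicGeometry/Motives`, namespace `Literature.AlgebraicGeometry.Motives`.  THEOREMS ONLY (no definition, no named
fact, no instance, no notation).  Cell `hodgecm-mathlib` (D-0151), F-2d road (R-def) «theorem of the cube over a NON-reduced base», brick
D5c-α1 (author B-p07 (g16)): the plumbing between the `R`-level family `(X ⊗ Y) ⊗ W → W` and the `A`-level family `X_A ⊗ Y_A → Spec A`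
(`X_A = ρ^*X` for a morphism `ρ : Spec A → Spec R`, `a : Spec A → W` over `R`) consumed by ★ `Motives/CubeStepIRing.cubeStepI_localRing`
and ★/in-lane `Motives/CubeSeesawKrull`.  Everything is stated at the level of Mathlib's `pullback.lift` / `pullback.map` between literal
fibre products (the `Over`-level spellings `((X ⊗ Y) ◁ a).left`, `((Over.pullback ρ).map φ).left` reduce to these by Mathlib
`Over.whiskerLeft_left` / `Over.whiskerRight_left` (`rfl`) and `Over.pullback` + `Over.homMk_left`), because rewriting across the two
`Over` spellings of the same fibre product is not instance-transparent.

* §1 `slice_tensorator_eq_map` — `(λ⁻¹ ≫ x_A ▷ Y_A) ≫ μ = ρ^*(λ⁻¹ ≫ x ▷ Y)` for ANY commutative `A` (★ `sliceLeft_pullback` is typed for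
  a field); `lift_fst_comp_map_eq` — `(pr₁ ≫ φ, pr₂) ≫ (1 × a) = (1 × a) ≫ (φ × 1)` on fibre products (the face compatibility);
* §2 `exists_lift_to_local`, `exists_lift_from_local` — comparison morphisms between `P ×_R S` and `(P ×_R Spec A) ×_A S` for
  `s : S → Spec A` over `ρ`, with their compatibilities with the maps to `P ×_R W`;
* §3 `nonempty_unit_iso_pullback_of_comp_eq` (+ two nested variants) — transport of «`M` is trivial» (Mathlib `pullbackComp/Congr`, ★
  `pullbackUnitIso`).

HC_CM is proved only modulo the 7 printed citations until rung 0 closes; nothing here is about HC.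

## References
* [GortzWedhorn2020] U. Görtz, T. Wedhorn, *Algebraic Geometry I*, 2nd ed. (2020), Section (4.7) (pp. 107–108) (fibre products, base change).
* [MumfordAV1970] D. Mumford, *Abelian Varieties* (1970), §6 and §10 (the families `X × Y × T → T`).
-/

noncomputable section

universe u

open CategoryTheory CategoryTheory.Limits AlgebraicGeometry MonoidalCategory CartesianMonoidalCategory
open Literature.AlgebraicGeometry.Modules Literature.AlgebraicGeometry.AbelianSchemes.AbelianSchemeOver

namespace Literature.AlgebraicGeometry.Motives

/-! ## §1 Slices under the tensorator; the face square on fibre products -/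

/-- **The slice `{x_A} × Y_A → X_A ⊗ Y_A` followed by the tensorator `μ` is `ρ^*` of the slice `{x} × Y → X ⊗ Y`** — ★ `sliceLeft_pullback`
for an arbitrary commutative `A` (monoidality of Mathlib's `Over.pullback`). [cite: GortzWedhorn2020, Section (4.7) (pp. 107–108)] -/
theorem slice_tensorator_eq_map {R A : Type u} [CommRing R] [CommRing A] (ρ : Spec (.of A) ⟶ Spec (.of R)) {X : SchemeOver R}
    (x : 𝟙_ (SchemeOver R) ⟶ X) (Y : SchemeOver R) :
    ((λ_ ((Over.pullback ρ).obj Y)).inv ≫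
        (Functor.LaxMonoidal.ε (Over.pullback ρ) ≫ (Over.pullback ρ).map x) ▷ (Over.pullback ρ).obj Y) ≫
        (Functor.Monoidal.μIso (Over.pullback ρ) X Y).hom = (Over.pullback ρ).map ((λ_ Y).inv ≫ x ▷ Y) := by
  rw [Functor.Monoidal.μIso_hom, comp_whiskerRight, Category.assoc, Category.assoc, Functor.LaxMonoidal.μ_natural_left,
    Functor.LaxMonoidal.left_unitality_inv_assoc, ← Functor.map_comp]

/-- The same for the second slice `X_A × {y_A} → X_A ⊗ Y_A`. [cite: GortzWedhorn2020, Section (4.7) (pp. 107–108)] -/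
theorem slice_tensorator_eq_map' {R A : Type u} [CommRing R] [CommRing A] (ρ : Spec (.of A) ⟶ Spec (.of R)) (X : SchemeOver R)
    {Y : SchemeOver R} (y : 𝟙_ (SchemeOver R) ⟶ Y) :
    ((ρ_ ((Over.pullback ρ).obj X)).inv ≫
        (Over.pullback ρ).obj X ◁ (Functor.LaxMonoidal.ε (Over.pullback ρ) ≫ (Over.pullback ρ).map y)) ≫
        (Functor.Monoidal.μIso (Over.pullback ρ) X Y).hom = (Over.pullback ρ).map ((ρ_ X).inv ≫ X ◁ y) := by
  rw [Functor.Monoidal.μIso_hom, MonoidalCategory.whiskerLeft_comp, Category.assoc, Category.assoc,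
    Functor.LaxMonoidal.μ_natural_right, Functor.LaxMonoidal.right_unitality_inv_assoc, ← Functor.map_comp]

/-- **The face square on fibre products**: for `φ : U → V` over `B`, `ρ : T' → B`, `w : T → B`, `aT : T' → T` with `aT ≫ w = ρ`:
`(pr₁ ≫ φ, pr₂) ≫ (1 × aT) = (1 × aT) ≫ (φ × 1)` as maps `U ×_B T' → V ×_B T`. [cite: GortzWedhorn2020, Section (4.7) (pp. 107–108)] -/
theorem lift_fst_comp_map_eq {B U V T T' : Scheme.{u}} (fU : U ⟶ B) (fV : V ⟶ B) (φ : U ⟶ V) (hφ : φ ≫ fV = fU)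
    (w : T ⟶ B) (ρ : T' ⟶ B) (aT : T' ⟶ T) (ha : aT ≫ w = ρ) :
    pullback.lift (pullback.fst fU ρ ≫ φ) (pullback.snd fU ρ) (by rw [Category.assoc, hφ, pullback.condition]) ≫
        pullback.map fV ρ fV w (𝟙 V) aT (𝟙 B) (by rw [Category.comp_id, Category.id_comp]) (by rw [Category.comp_id, ha]) =
      pullback.map fU ρ fU w (𝟙 U) aT (𝟙 B) (by rw [Category.comp_id, Category.id_comp]) (by rw [Category.comp_id, ha]) ≫
        pullback.map fU w fV w φ (𝟙 T) (𝟙 B) (by rw [Category.comp_id, hφ]) (by rw [Category.comp_id, Category.id_comp]) := by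
  apply pullback.hom_ext
  · simp only [pullback.map, Category.assoc, pullback.lift_fst, pullback.lift_fst_assoc, Category.comp_id]
  · simp only [pullback.map, Category.assoc, pullback.lift_snd, pullback.lift_snd_assoc, Category.comp_id]

/-! ## §2 Comparison of the test families -/

/-- **To the local family**: for `s : S → Spec A` with `s ≫ ρ = fS`, a morphism `P ×_R S → (P ×_R Spec A) ×_A S` (the first factor read
through a morphism `m⁻¹ : P ×_R Spec A → Q` over `Spec A`, e.g. the inverse tensorator) compatible with the projections.
[cite: GortzWedhorn2020, Section (4.7) (pp. 107–108)] -/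
theorem exists_lift_to_local {R A : Type u} [CommRing R] [CommRing A] (ρ : Spec (.of A) ⟶ Spec (.of R)) {P S Q : Scheme.{u}}
    (fP : P ⟶ Spec (.of R)) (fS : S ⟶ Spec (.of R)) (s : S ⟶ Spec (.of A)) (hs : s ≫ ρ = fS) (fQ : Q ⟶ Spec (.of A))
    (m : Q ⟶ pullback fP ρ) (mi : pullback fP ρ ⟶ Q) (hmi : mi ≫ m = 𝟙 _) (hQ : m ≫ pullback.snd fP ρ = fQ) :
    ∃ e : pullback fP fS ⟶ pullback fQ s,
      e ≫ pullback.fst fQ s ≫ m = pullback.map fP fS fP ρ (𝟙 P) s (𝟙 _) (by rw [Category.comp_id, Category.id_comp])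
        (by rw [Category.comp_id, hs]) ∧ e ≫ pullback.snd fQ s = pullback.snd fP fS := by
  have hQ' : mi ≫ fQ = pullback.snd fP ρ := by rw [← hQ, ← Category.assoc, hmi, Category.id_comp]
  refine ⟨pullback.lift (pullback.map fP fS fP ρ (𝟙 P) s (𝟙 _) (by rw [Category.comp_id, Category.id_comp])
    (by rw [Category.comp_id, hs]) ≫ mi) (pullback.snd fP fS) ?_, ?_, ?_⟩
  · rw [Category.assoc, hQ', pullback.lift_snd]
  · rw [pullback.lift_fst_assoc, Category.assoc, hmi, Category.comp_id]
  · rw [pullback.lift_snd]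

/-- **From the local family**: a morphism `(P ×_R Spec A) ×_A S → P ×_R S` compatible with the projections.
[cite: GortzWedhorn2020, Section (4.7) (pp. 107–108)] -/
theorem exists_lift_from_local {R A : Type u} [CommRing R] [CommRing A] (ρ : Spec (.of A) ⟶ Spec (.of R)) {P S Q : Scheme.{u}}
    (fP : P ⟶ Spec (.of R)) (fS : S ⟶ Spec (.of R)) (s : S ⟶ Spec (.of A)) (hs : s ≫ ρ = fS) (fQ : Q ⟶ Spec (.of A))
    (m : Q ⟶ pullback fP ρ) (hQ : m ≫ pullback.snd fP ρ = fQ) :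
    ∃ e' : pullback fQ s ⟶ pullback fP fS,
      e' ≫ pullback.fst fP fS = pullback.fst fQ s ≫ m ≫ pullback.fst fP ρ ∧ e' ≫ pullback.snd fP fS = pullback.snd fQ s := by
  refine ⟨pullback.lift (pullback.fst fQ s ≫ m ≫ pullback.fst fP ρ) (pullback.snd fQ s) ?_, pullback.lift_fst _ _ _,
    pullback.lift_snd _ _ _⟩
  rw [Category.assoc, Category.assoc, pullback.condition, ← Category.assoc m, hQ, pullback.condition_assoc, hs]

/-! ## §3 Transport of triviality of a module -/

/-- If `e ≫ q = p` and `q^*M` is trivial then `p^*M` is trivial. [cite: GortzWedhorn2020, Section (4.7) (pp. 107–108)] -/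
theorem nonempty_unit_iso_pullback_of_comp_eq {P₁ P₂ P₃ : Scheme.{u}} (e : P₁ ⟶ P₂) (q : P₂ ⟶ P₃) (p : P₁ ⟶ P₃) (h : e ≫ q = p)
    (M : P₃.Modules) (hM : Nonempty (unitModule P₂ ≅ (Scheme.Modules.pullback q).obj M)) :
    Nonempty (unitModule P₁ ≅ (Scheme.Modules.pullback p).obj M) := by
  obtain ⟨ψ⟩ := hM
  exact ⟨(RigidifiedLineBundle.pullbackUnitIso e).symm ≪≫ (Scheme.Modules.pullback e).mapIso ψ ≪≫
    (Scheme.Modules.pullbackComp e q).app M ≪≫ (Scheme.Modules.pullbackCongr h).app M⟩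

/-- If `e ≫ q₁ ≫ q₂ = p` and `q₁^*q₂^*M` is trivial then `p^*M` is trivial. [cite: GortzWedhorn2020, Section (4.7) (pp. 107–108)] -/
theorem nonempty_unit_iso_pullback_of_comp_comp_eq {P₁ P₂ P₃ P₄ : Scheme.{u}} (e : P₁ ⟶ P₂) (q₁ : P₂ ⟶ P₃) (q₂ : P₃ ⟶ P₄)
    (p : P₁ ⟶ P₄) (h : e ≫ q₁ ≫ q₂ = p) (M : P₄.Modules)
    (hM : Nonempty (unitModule P₂ ≅ (Scheme.Modules.pullback q₁).obj ((Scheme.Modules.pullback q₂).obj M))) :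
    Nonempty (unitModule P₁ ≅ (Scheme.Modules.pullback p).obj M) := by
  obtain ⟨ψ⟩ := hM
  exact nonempty_unit_iso_pullback_of_comp_eq e (q₁ ≫ q₂) p (by rw [h]) M ⟨ψ ≪≫ (Scheme.Modules.pullbackComp q₁ q₂).app M⟩

/-- If `e' ≫ p = q₁ ≫ q₂` and `p^*M` is trivial then `q₁^*q₂^*M` is trivial. [cite: GortzWedhorn2020, Section (4.7) (pp. 107–108)] -/
theorem nonempty_unit_iso_pullback_pullback_of_comp_eq {P₁ P₂ P₃ P₄ : Scheme.{u}} (e' : P₁ ⟶ P₂) (p : P₂ ⟶ P₄) (q₁ : P₁ ⟶ P₃)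
    (q₂ : P₃ ⟶ P₄) (h : e' ≫ p = q₁ ≫ q₂) (M : P₄.Modules)
    (hM : Nonempty (unitModule P₂ ≅ (Scheme.Modules.pullback p).obj M)) :
    Nonempty (unitModule P₁ ≅ (Scheme.Modules.pullback q₁).obj ((Scheme.Modules.pullback q₂).obj M)) := by
  obtain ⟨φ⟩ := nonempty_unit_iso_pullback_of_comp_eq e' p (q₁ ≫ q₂) h M hM
  exact ⟨φ ≪≫ ((Scheme.Modules.pullbackComp q₁ q₂).app M).symm⟩

end Literature.AlgebraicGeometry.Motives

end
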